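import Mathlib.LinearAlgebra.Eigenspace.Charpoly
import Mathlib.LinearAlgebra.Eigenspace.Minpoly
import Mathlib.LinearAlgebra.FiniteDimensional.Lemmas
import Mathlib.LinearAlgebra.Matrix.Charpoly.Coeff
import Mathlib.LinearAlgebra.Charpoly.ToMatrix
import Mathlib.FieldTheory.IsAlgClosed.AlgebraicClosure
import Mathlib.FieldTheory.Separable
import HarnessLib

/-!
# The centraliser of a matrix with SEPARABLE characteristic polynomial is commutative

Topic `LinearAlgebra/Matrix`; namespace `Literature.LinearAlgebra.Matrix`.  PROOF FILE over Mathlib only: theorems, no definition, no named fact,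
no `sorry`.

A square matrix `g` over a field whose characteristic polynomial is separable (no repeated root in an algebraic closure) is REGULAR SEMISIMPLE; its
commutant is the commutative algebra `K[g]`, in particular any two matrices commuting with `g` commute with each other.  We prove the commutativity
statement, which is what the theory of orbital integrals consumes («the centraliser `G_γ` of a regular semisimple `γ` is a (maximal) torus», hence
abelian and unimodular: [Rogawski1990, §3.1 p. 19, §4.9 p. 54]; [DeitmarEchterhoff2014, Thm. 1.5.3] for the invariant measure on `G ⧸ G_γ`), in the
generality the adelic and local carriers need: matrices over any commutative ring `R` that EMBEDS into a product of fields (`R = ∏_{w ∣ v} L_w`, or the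
adele ring `𝔸_L ↪ ∏_w L_w`).

* §1 (algebraically closed `K`, `f : Module.End K V`): `f.charpoly` separable ⇒ `V` has a basis of eigenvectors of `f` with pairwise distinct eigenvalues, on
  which every endomorphism commuting with `f` acts DIAGONALLY (`apply_eigenbasis_eq_smul_of_commute`); hence `Commute a f → Commute b f → Commute a b`
  (`Module.End.commute_of_commute_of_charpoly_separable`).
* §2 matrices over any field (base change to the algebraic closure, ★ Mathlib `Matrix.charpoly_map`, `Polynomial.Separable.map`, injectivity of
  `Matrix.map`): `Matrix.commute_of_commute_of_charpoly_separable`.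
* §3 matrices over a product of fields `Π i, K i` (componentwise) and over any commutative ring with an injective ring hom into such a product:
  `Matrix.commute_of_commute_of_charpoly_separable_of_injective`; unit ∕ subgroup forms: for `γ` in a subgroup `U ≤ GL n R` with separable
  characteristic polynomial, `Subgroup.centralizer {γ}` is commutative (`Subgroup.mul_comm_of_mem_centralizer_of_charpoly_separable`).

## References
* [Rogawski1990] J. D. Rogawski, *Automorphic Representations of Unitary Groups in Three Variables*, Ann. of Math. Studies 123 (1990), §3.1 p. 19 (regular
  elements), §4.9 p. 54.
* [DeitmarEchterhoff2014] A. Deitmar, S. Echterhoff, *Principles of Harmonic Analysis*, 2nd ed. (2014), Thm. 1.5.3.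
* [Bourbaki, Algèbre VII §5 no. 4] (cyclic endomorphisms and their commutant) — background.
-/

namespace Literature.LinearAlgebra.Matrix

open Polynomial Module

/-! ## §1 Endomorphisms with separable characteristic polynomial over an algebraically closed field -/

section AlgClosed

variable {K V : Type*} [Field K] [IsAlgClosed K] [AddCommGroup V] [Module K V] [FiniteDimensional K V]

/-- Over an algebraically closed field, an endomorphism with SEPARABLE characteristic polynomial has `finrank K V` pairwise distinct eigenvalues: its
characteristic polynomial has exactly `finrank K V` roots, without repetition. [cite: Rogawski1990, §3.1 p. 19] -/
theorem card_roots_charpoly_eq_finrank (f : End K V) : f.charpoly.roots.card = Module.finrank K V := by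
  rw [← f.charpoly_natDegree]
  exact (IsAlgClosed.splits f.charpoly).natDegree_eq_card_roots.symm

omit [IsAlgClosed K] in
/-- Every root of the characteristic polynomial is an eigenvalue (Mathlib `hasEigenvalue_iff_isRoot_charpoly`), so it carries an eigenvector.
[cite: Rogawski1990, §3.1 p. 19] -/
theorem exists_hasEigenvector_of_mem_roots (f : End K V) {μ : K} (hμ : μ ∈ f.charpoly.roots) : ∃ v : V, f.HasEigenvector μ v :=
  ((End.hasEigenvalue_iff_isRoot_charpoly f μ).mpr (isRoot_of_mem_roots hμ)).exists_hasEigenvector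

omit [IsAlgClosed K] [FiniteDimensional K V] in
/-- **An endomorphism commuting with `f` acts DIAGONALLY on any eigenbasis of `f` with pairwise distinct eigenvalues**: if `b` is a basis with
`f (b i) = μ i • b i`, `μ` injective, and `a` commutes with `f`, then `a (b i) = (b.repr (a (b i)) i) • b i`.  (The coordinates of `w := a (b i)` off `i`
vanish: `f w = μ i • w`, while in coordinates `f` multiplies the `j`-th coordinate by `μ j ≠ μ i`.) [cite: Rogawski1990, §3.1 p. 19] -/
theorem apply_eigenbasis_eq_smul_of_commute {ι : Type*} [Fintype ι] (f : End K V) (b : Basis ι K V) (μ : ι → K)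
    (hμ : Function.Injective μ) (hb : ∀ i, f (b i) = μ i • b i) {a : End K V} (ha : Commute a f) (i : ι) :
    a (b i) = (b.repr (a (b i)) i) • b i := by
  set w := a (b i) with hw
  -- `f w = μ i • w`
  have hfw : f w = μ i • w := by
    rw [hw, ← Module.End.mul_apply, ← ha.eq, Module.End.mul_apply, hb i, map_smul]
  -- `f` is diagonal in the coordinates of `b`
  have hfw' : f w = ∑ j, (b.repr w j * μ j) • b j := by
    conv_lhs => rw [← b.sum_repr w]
    rw [map_sum]
    refine Finset.sum_congr rfl fun j _ => ?_
    rw [map_smul, hb j, smul_smul]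
  have hdiag : ∀ j, b.repr (f w) j = b.repr w j * μ j := fun j => by
    rw [hfw', b.repr_sum_self]
  -- hence `b.repr w j = 0` for `j ≠ i`
  have hzero : ∀ j, j ≠ i → b.repr w j = 0 := by
    intro j hj
    have h1 : b.repr (f w) j = μ i * b.repr w j := by
      rw [hfw, map_smul, Finsupp.smul_apply, smul_eq_mul]
    have h2 : (μ j - μ i) * b.repr w j = 0 := by
      rw [sub_mul, mul_comm (μ j), ← hdiag j, h1, sub_self]
    rcases mul_eq_zero.mp h2 with h | h
    · exact absurd (hμ (sub_eq_zero.mp h)) hj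
    · exact h
  -- so `w` is its `i`-th coordinate times `b i`
  conv_lhs => rw [← b.sum_repr w]
  rw [Finset.sum_eq_single i]
  · intro k _ hk
    rw [hzero k hk, zero_smul]
  · intro hi
    exact absurd (Finset.mem_univ i) hi

/-- **Two endomorphisms commuting with an endomorphism of SEPARABLE characteristic polynomial commute with each other** (algebraically closed field):
both act diagonally on an eigenbasis of `f`. [cite: Rogawski1990, §3.1 p. 19] -/
theorem _root_.Module.End.commute_of_commute_of_charpoly_separable (f : End K V) (hsep : f.charpoly.Separable) {a c : End K V}
    (ha : Commute a f) (hc : Commute c f) : Commute a c := by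
  classical
  -- the eigenbasis, indexed by the roots of the characteristic polynomial
  set S := f.charpoly.roots.toFinset with hS
  have hv : ∀ μ : S, ∃ v : V, f.HasEigenvector (μ : K) v :=
    fun μ => exists_hasEigenvector_of_mem_roots f (Multiset.mem_toFinset.mp μ.2)
  choose v hv using hv
  have hli : LinearIndependent K v :=
    f.eigenvectors_linearIndependent' (fun μ : S => (μ : K)) Subtype.val_injective v hv
  have hcard : Fintype.card S = Module.finrank K V := by
    rw [Fintype.card_coe, hS, Multiset.toFinset_card_of_nodup (nodup_roots hsep), card_roots_charpoly_eq_finrank f]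
  let b : Basis S K V := basisOfLinearIndependentOfCardEqFinrank' v hli hcard
  have hbv : ∀ μ : S, b μ = v μ := fun μ => by
    simp only [b, basisOfLinearIndependentOfCardEqFinrank', Basis.mk_apply]
  have hb : ∀ μ : S, f (b μ) = (μ : K) • b μ := fun μ => by
    rw [hbv]
    exact (hv μ).apply_eq_smul
  -- `a` and `c` are both diagonal on `b`, hence commute
  change a * c = c * a
  refine b.ext fun μ => ?_
  have haμ := apply_eigenbasis_eq_smul_of_commute f b (fun μ : S => (μ : K)) Subtype.val_injective hb ha μ
  have hcμ := apply_eigenbasis_eq_smul_of_commute f b (fun μ : S => (μ : K)) Subtype.val_injective hb hc μ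
  set α := b.repr (a (b μ)) μ
  set γ := b.repr (c (b μ)) μ
  rw [Module.End.mul_apply, Module.End.mul_apply, hcμ, LinearMap.map_smul, haμ, LinearMap.map_smul, hcμ, smul_smul, smul_smul,
    mul_comm]

end AlgClosed

/-! ## §2 Matrices over a field -/

section Field

variable {n : Type*} [Fintype n] [DecidableEq n]

/-- Matrices over an ALGEBRAICALLY CLOSED field: two matrices commuting with a matrix of separable characteristic polynomial commute (§1 through
`Matrix.toLin'`). [cite: Rogawski1990, §3.1 p. 19] -/
theorem commute_of_commute_of_charpoly_separable_of_isAlgClosed {K : Type*} [Field K] [IsAlgClosed K] {g a c : _root_.Matrix n n K}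
    (hsep : g.charpoly.Separable) (ha : Commute a g) (hc : Commute c g) : Commute a c := by
  have hchar : (Matrix.toLin' g).charpoly = g.charpoly := by
    rw [← LinearMap.charpoly_toMatrix (Matrix.toLin' g) (Pi.basisFun K n), LinearMap.toMatrix_eq_toMatrix', LinearMap.toMatrix'_toLin']
  have hsep' : (Matrix.toLin' g).charpoly.Separable := by rw [hchar]; exact hsep
  have ha' : Commute (Matrix.toLin' a) (Matrix.toLin' g) := by
    change Matrix.toLin' a ∘ₗ Matrix.toLin' g = Matrix.toLin' g ∘ₗ Matrix.toLin' a
    rw [← Matrix.toLin'_mul, ← Matrix.toLin'_mul, ha.eq]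
  have hc' : Commute (Matrix.toLin' c) (Matrix.toLin' g) := by
    change Matrix.toLin' c ∘ₗ Matrix.toLin' g = Matrix.toLin' g ∘ₗ Matrix.toLin' c
    rw [← Matrix.toLin'_mul, ← Matrix.toLin'_mul, hc.eq]
  have key := Module.End.commute_of_commute_of_charpoly_separable (Matrix.toLin' g) hsep' ha' hc'
  have : Matrix.toLin' (a * c) = Matrix.toLin' (c * a) := by
    rw [Matrix.toLin'_mul, Matrix.toLin'_mul]
    exact key.eq
  exact Matrix.toLin'.injective this

/-- **Matrices over ANY field**: two matrices commuting with a matrix of SEPARABLE characteristic polynomial commute (base change to the algebraic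
closure: `Matrix.charpoly_map`, `Polynomial.Separable.map`, injectivity of `Matrix.map`). [cite: Rogawski1990, §3.1 p. 19] -/
theorem commute_of_commute_of_charpoly_separable {K : Type*} [Field K] {g a c : _root_.Matrix n n K} (hsep : g.charpoly.Separable)
    (ha : Commute a g) (hc : Commute c g) : Commute a c := by
  let φ := algebraMap K (AlgebraicClosure K)
  have hsep' : (g.map φ).charpoly.Separable := by
    rw [Matrix.charpoly_map]
    exact hsep.map
  have ha' : Commute (a.map φ) (g.map φ) := by
    change a.map φ * g.map φ = g.map φ * a.map φ
    rw [← Matrix.map_mul, ← Matrix.map_mul, ha.eq]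
  have hc' : Commute (c.map φ) (g.map φ) := by
    change c.map φ * g.map φ = g.map φ * c.map φ
    rw [← Matrix.map_mul, ← Matrix.map_mul, hc.eq]
  have key := commute_of_commute_of_charpoly_separable_of_isAlgClosed hsep' ha' hc'
  have : (a * c).map φ = (c * a).map φ := by
    rw [Matrix.map_mul, Matrix.map_mul]
    exact key.eq
  exact Matrix.map_injective φ.injective this

end Field

/-! ## §3 Matrices over a product of fields, and over any commutative ring embedding into one; centralisers in `GL_n` and its subgroups -/

section Product

variable {n : Type*} [Fintype n] [DecidableEq n] {I : Type*} {K : I → Type*} [∀ i, Field (K i)]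

/-- **Matrices over a PRODUCT OF FIELDS**: commutation is checked componentwise (`Matrix.map (Pi.evalRingHom K i)`), and the characteristic polynomial of
each component is the image of the characteristic polynomial, hence separable. [cite: Rogawski1990, §3.1 p. 19] -/
theorem commute_of_commute_of_charpoly_separable_pi {g a c : _root_.Matrix n n (Π i, K i)} (hsep : g.charpoly.Separable)
    (ha : Commute a g) (hc : Commute c g) : Commute a c := by
  have key : ∀ i, Commute (a.map (Pi.evalRingHom K i)) (c.map (Pi.evalRingHom K i)) := by
    intro i
    refine commute_of_commute_of_charpoly_separable (g := g.map (Pi.evalRingHom K i)) ?_ ?_ ?_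
    · rw [Matrix.charpoly_map]
      exact hsep.map
    · change a.map _ * g.map _ = g.map _ * a.map _
      rw [← Matrix.map_mul, ← Matrix.map_mul, ha.eq]
    · change c.map _ * g.map _ = g.map _ * c.map _
      rw [← Matrix.map_mul, ← Matrix.map_mul, hc.eq]
  change a * c = c * a
  ext j k i
  have h := congrFun (congrFun (key i).eq j) k
  rw [← Matrix.map_mul, ← Matrix.map_mul] at h
  exact h

/-- **Matrices over a commutative ring `R` EMBEDDING into a product of fields** (`ι : R →+* Π i, K i` injective; e.g. a reduced ring, the local rings
`L ⊗ L⁺_v = ∏_{w∣v} L_w`, the adele ring `𝔸_L ↪ ∏_w L_w`): two matrices commuting with a matrix of separable characteristic polynomial commute.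
[cite: Rogawski1990, §3.1 p. 19] -/
theorem commute_of_commute_of_charpoly_separable_of_injective {R : Type*} [CommRing R] (ι : R →+* Π i, K i) (hι : Function.Injective ι)
    {g a c : _root_.Matrix n n R} (hsep : g.charpoly.Separable) (ha : Commute a g) (hc : Commute c g) : Commute a c := by
  have hsep' : (g.map ι).charpoly.Separable := by
    rw [Matrix.charpoly_map]
    exact hsep.map
  have ha' : Commute (a.map ι) (g.map ι) := by
    change a.map ι * g.map ι = g.map ι * a.map ι
    rw [← Matrix.map_mul, ← Matrix.map_mul, ha.eq]
  have hc' : Commute (c.map ι) (g.map ι) := by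
    change c.map ι * g.map ι = g.map ι * c.map ι
    rw [← Matrix.map_mul, ← Matrix.map_mul, hc.eq]
  have key := commute_of_commute_of_charpoly_separable_pi hsep' ha' hc'
  have : (a * c).map ι = (c * a).map ι := by
    rw [Matrix.map_mul, Matrix.map_mul]
    exact key.eq
  exact Matrix.map_injective hι this

/-- **`GL_n`-form**: for `γ ∈ GL n R` (`R` embedding into a product of fields) with separable characteristic polynomial, any two elements of `GL n R`
commuting with `γ` commute. [cite: Rogawski1990, §3.1 p. 19] -/
theorem _root_.Matrix.GeneralLinearGroup.commute_of_commute_of_charpoly_separable {R : Type*} [CommRing R] (ι : R →+* Π i, K i)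
    (hι : Function.Injective ι) {γ a c : GL n R} (hsep : (γ : _root_.Matrix n n R).charpoly.Separable) (ha : Commute a γ) (hc : Commute c γ) :
    Commute a c := by
  have ha' : Commute (a : _root_.Matrix n n R) γ := by
    change (a : _root_.Matrix n n R) * γ = γ * a
    rw [← Units.val_mul, ← Units.val_mul, ha.eq]
  have hc' : Commute (c : _root_.Matrix n n R) γ := by
    change (c : _root_.Matrix n n R) * γ = γ * c
    rw [← Units.val_mul, ← Units.val_mul, hc.eq]
  have key := commute_of_commute_of_charpoly_separable_of_injective ι hι hsep ha' hc'
  exact Units.ext (by rw [Units.val_mul, Units.val_mul]; exact key.eq)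

/-- **Subgroup form (the centraliser of a regular element is abelian)**: for a subgroup `U ≤ GL n R` (`R` embedding into a product of fields — e.g. a
unitary group `U(H)(L⁺_v) ≤ GL_N(∏_{w∣v} L_w)`) and `γ ∈ U` with SEPARABLE characteristic polynomial, any two elements of `Subgroup.centralizer {γ}`
commute — the hypothesis `hcomm` under which the tree's invariant orbital measure on `U ⧸ U_γ` is constructed for every Haar normalisation.
[cite: Rogawski1990, §3.1 p. 19; §4.9 p. 54] [cite: DeitmarEchterhoff2014, Thm. 1.5.3] -/
theorem _root_.Subgroup.mul_comm_of_mem_centralizer_of_charpoly_separable {R : Type*} [CommRing R] (ι : R →+* Π i, K i)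
    (hι : Function.Injective ι) (U : Subgroup (GL n R)) (γ : U) (hsep : ((γ : GL n R) : _root_.Matrix n n R).charpoly.Separable) :
    ∀ a ∈ Subgroup.centralizer ({γ} : Set U), ∀ c ∈ Subgroup.centralizer ({γ} : Set U), a * c = c * a := by
  intro a ha c hc
  have ha' : Commute (a : GL n R) γ := by
    have h := (Subgroup.mem_centralizer_singleton_iff.mp ha)
    -- `h : γ * a = a * γ` in `U`
    change (a : GL n R) * γ = γ * a
    rw [← Subgroup.coe_mul, ← Subgroup.coe_mul, h]
  have hc' : Commute (c : GL n R) γ := by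
    have h := (Subgroup.mem_centralizer_singleton_iff.mp hc)
    change (c : GL n R) * γ = γ * c
    rw [← Subgroup.coe_mul, ← Subgroup.coe_mul, h]
  have key := Matrix.GeneralLinearGroup.commute_of_commute_of_charpoly_separable ι hι hsep ha' hc'
  exact Subtype.ext (by rw [Subgroup.coe_mul, Subgroup.coe_mul]; exact key.eq)

end Product

end Literature.LinearAlgebra.Matrix
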